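import Mathlib

/-!
# Route BarrierLever — item `PartitionMinorsHitByVP` (stmt-ValiantsHypothesis-19717), line `hidden-states`:
# DUAL-VECTOR CERTIFICATES FOR UNIPOTENT TABLES — «annihilating functional ⇒ the exchange matrix is nonsingular»

Helper file (`--supports stmt-ValiantsHypothesis-19717`; cell valiant-natproofs, 𝒟-side door (c), registered line
`Cruxes/PartitionMinorsHitByVP/Lines/hidden_states.lean` v8; prover seat val-np-p6 gen 16).  Closes NO item; definition-free.

THE ABSTRACT ENGINE of memo HOME/val-np-p6/g16/MEMO-valnp6-g16.md §2–3.  A TABLE on a finite index type `ι` is a weight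
`w : ι → ι → ℂ` («coordinate `a` of the hidden point of `J` is `Σ_{q ∈ J} w a q`»); it is UNIPOTENT for a potential `pot : ι → ℕ` when
`w a a = 1` and every other source is strictly lower (`w a q ≠ 0 → q = a ∨ pot q < pot a`).  The exchange matrix of `(B, X₀, Y₀)`
has rows the monomials `S` with `|S| ≤ k`, `S ≠ X₀`, together with `Y₀`, and columns the points `J`, `|J| ≤ k`; entry
`∏_{a ∈ S} Σ_{q ∈ J} w a q`.
* `mono_expand` — `∏_{a∈S} Σ_{q∈J} w a q = Σ_φ (∏_{a∈S} w a (φ a))·[S.image φ ⊆ J]` over the SOURCE MAPS `φ` (functions `ι → ι`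
  fixed to the identity off `S`): the factorisation `M = Z · C` through the inclusion matrix.
* `moebius_zero` — `Σ_{R ⊆ J} g R = 0` for all `|J| ≤ k` forces `g R = 0` for `|R| ≤ k`.
* `pot_image_le` / `_eq` — a source map with nonzero weight lowers the potential of the image, strictly unless it is the identity.
* ★ `coeffs_eq_zero_of_dual` — if a function `ζ` on sets (supported on `|R| ≤ k`) ANNIHILATES every row `S ≠ X₀` with `|S| ≤ k`
  (`Σ_φ wt(φ) ζ(S.image φ) = 0`) and does NOT annihilate `Y₀`, then the rows are linearly independent as functions on the points;
  ★ `det_ne_zero_of_dual` — hence every square enumeration of that exchange matrix has nonzero determinant.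
The path table of `P_k` and its staircase functional (sibling files `…PathTableStaircase`, `…PathTable`) instantiate this.

WHAT THIS IS NOT: nothing here is specific to `P_k`; no item statement; nothing on crux 14610 or VP ≠ VNP.
-/

set_option linter.dupNamespace false

namespace Summit.ValiantsHypothesis.ValiantsHypothesis.Theorems.BarrierLever.HiddenStates

open Finset

noncomputable section

namespace PathTable

variable {ι : Type} [Fintype ι] [DecidableEq ι]

/-! ## Source maps and the expansion of a monomial -/

/-- **Expansion of a monomial over source maps.**  With `maps S = {φ : ι → ι | φ a = a off S}`:
`∏_{a∈S} Σ_{q∈J} w a q = Σ_{φ ∈ maps S} (∏_{a∈S} w a (φ a)) · [∀ a ∈ S, φ a ∈ J]`. -/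
theorem mono_expand (w : ι → ι → ℂ) (S J : Finset ι) :
    ∏ a ∈ S, ∑ q ∈ J, w a q =
      ∑ φ ∈ Fintype.piFinset (fun a => if a ∈ S then (Finset.univ : Finset ι) else {a}),
        (∏ a ∈ S, w a (φ a)) * (if ∀ a ∈ S, φ a ∈ J then 1 else 0) := by
  classical
  -- extend the product to all of `ι`
  have h1 : ∏ a ∈ S, ∑ q ∈ J, w a q =
      ∏ a : ι, ∑ q ∈ (if a ∈ S then (Finset.univ : Finset ι) else {a}),
        (if a ∈ S then (if q ∈ J then w a q else 0) else 1) := by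
    rw [← Finset.prod_filter_mul_prod_filter_not Finset.univ (· ∈ S)]
    have hS : Finset.univ.filter (· ∈ S) = S := by ext a; simp
    rw [hS]
    have h2 : ∏ a ∈ Finset.univ.filter (fun a => ¬ a ∈ S),
        ∑ q ∈ (if a ∈ S then (Finset.univ : Finset ι) else {a}),
          (if a ∈ S then (if q ∈ J then w a q else 0) else (1 : ℂ)) = 1 := by
      refine Finset.prod_eq_one fun a ha => ?_
      have ha' : a ∉ S := (Finset.mem_filter.1 ha).2
      simp [ha']
    rw [h2, mul_one]
    refine Finset.prod_congr rfl fun a ha => ?_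
    rw [if_pos ha]
    simp only [ha, if_true]
    rw [Finset.sum_ite_mem, Finset.univ_inter]
  rw [h1, Finset.prod_univ_sum]
  refine Finset.sum_congr rfl fun φ hφ => ?_
  rw [← Finset.prod_filter_mul_prod_filter_not Finset.univ (· ∈ S)]
  have hS : Finset.univ.filter (· ∈ S) = S := by ext a; simp
  rw [hS]
  have h2 : ∏ a ∈ Finset.univ.filter (fun a => ¬ a ∈ S),
      (if a ∈ S then (if φ a ∈ J then w a (φ a) else 0) else (1 : ℂ)) = 1 :=
    Finset.prod_eq_one fun a ha => by simp [(Finset.mem_filter.1 ha).2]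
  rw [h2, mul_one]
  by_cases hall : ∀ a ∈ S, φ a ∈ J
  · rw [if_pos hall, mul_one]
    exact Finset.prod_congr rfl fun a ha => by rw [if_pos ha, if_pos (hall a ha)]
  · rw [if_neg hall, mul_zero]
    push Not at hall
    obtain ⟨a, ha, hφa⟩ := hall
    exact Finset.prod_eq_zero ha (by rw [if_pos ha, if_neg hφa])

/-- the indicator `[∀ a ∈ S, φ a ∈ J]` is the sum over `R ⊆ J` of `[S.image φ = R]`. -/
theorem indicator_image_subset (S J : Finset ι) (φ : ι → ι) :
    (if ∀ a ∈ S, φ a ∈ J then (1 : ℂ) else 0) = ∑ R ∈ J.powerset, if S.image φ = R then 1 else 0 := by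
  rw [Finset.sum_ite_eq]
  by_cases h : ∀ a ∈ S, φ a ∈ J
  · rw [if_pos h, if_pos]
    exact Finset.mem_powerset.2 (Finset.image_subset_iff.2 h)
  · rw [if_neg h, if_neg]
    exact fun hm => h (Finset.image_subset_iff.1 (Finset.mem_powerset.1 hm))

/-- **The factorisation through the inclusion matrix**: `∏_{a∈S} Σ_{q∈J} w a q = Σ_{R ⊆ J} C(R, S)` with the transfer coefficient
`C(R,S) = Σ_{φ ∈ maps S} [S.image φ = R] ∏_{a∈S} w a (φ a)`. -/
theorem mono_eq_sum_powerset (w : ι → ι → ℂ) (S J : Finset ι) :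
    ∏ a ∈ S, ∑ q ∈ J, w a q =
      ∑ R ∈ J.powerset, ∑ φ ∈ Fintype.piFinset (fun a => if a ∈ S then (Finset.univ : Finset ι) else {a}),
        (if S.image φ = R then ∏ a ∈ S, w a (φ a) else 0) := by
  rw [mono_expand, Finset.sum_comm]
  refine Finset.sum_congr rfl fun φ _ => ?_
  rw [indicator_image_subset, Finset.mul_sum]
  refine Finset.sum_congr rfl fun R _ => ?_
  split_ifs <;> simp

/-! ## Möbius inversion on the truncated Boolean lattice -/

omit [Fintype ι] in
/-- If `Σ_{R ⊆ J} g R = 0` for every `J` with `|J| ≤ k`, then `g R = 0` for every `|R| ≤ k`. -/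
theorem moebius_zero {g : Finset ι → ℂ} {k : ℕ} (h : ∀ J : Finset ι, J.card ≤ k → ∑ R ∈ J.powerset, g R = 0) :
    ∀ R : Finset ι, R.card ≤ k → g R = 0 := by
  intro R
  induction R using Finset.strongInduction with
  | H R ih =>
    intro hR
    have h1 := h R hR
    rw [← Finset.insert_erase (Finset.mem_powerset_self R), Finset.sum_insert (Finset.notMem_erase _ _)] at h1
    have h2 : ∑ R' ∈ (R.powerset).erase R, g R' = 0 := by
      refine Finset.sum_eq_zero fun R' hR' => ?_
      obtain ⟨hne, hsub⟩ := Finset.mem_erase.1 hR'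
      have hss : R' ⊂ R := Finset.ssubset_iff_subset_ne.2 ⟨Finset.mem_powerset.1 hsub, hne⟩
      exact ih R' hss ((Finset.card_le_card hss.subset).trans hR)
    rw [h2, add_zero] at h1
    exact h1

/-! ## The potential: source maps with nonzero weight lower it -/

omit [Fintype ι] in
/-- the potential of an image is at most the potential summed along the map. -/
theorem sum_image_le_sum (pot : ι → ℕ) (S : Finset ι) (φ : ι → ι) :
    ∑ q ∈ S.image φ, pot q ≤ ∑ a ∈ S, pot (φ a) := by
  rw [← Finset.sum_fiberwise_of_maps_to (s := S) (t := S.image φ) (g := φ)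
    (fun a ha => Finset.mem_image_of_mem φ ha) (f := fun a => pot (φ a))]
  refine Finset.sum_le_sum fun q hq => ?_
  obtain ⟨a, ha, rfl⟩ := Finset.mem_image.1 hq
  have hmem : a ∈ S.filter (fun a' => φ a' = φ a) := Finset.mem_filter.2 ⟨ha, rfl⟩
  calc pot (φ a) = ∑ a' ∈ {a}, pot (φ a) := by simp
    _ ≤ ∑ a' ∈ S.filter (fun a' => φ a' = φ a), pot (φ a) :=
        Finset.sum_le_sum_of_subset_of_nonneg (Finset.singleton_subset_iff.2 hmem) fun _ _ _ => Nat.zero_le _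
    _ = ∑ a' ∈ S.filter (fun a' => φ a' = φ a), pot (φ a') :=
        Finset.sum_congr rfl fun a' ha' => by rw [(Finset.mem_filter.1 ha').2]

omit [Fintype ι] in
/-- **A source map with nonzero weight does not raise the potential** … -/
theorem pot_image_le (w : ι → ι → ℂ) (pot : ι → ℕ) (hw : ∀ a q, w a q ≠ 0 → q = a ∨ pot q < pot a)
    (S : Finset ι) (φ : ι → ι) (hφ : ∏ a ∈ S, w a (φ a) ≠ 0) :
    ∑ q ∈ S.image φ, pot q ≤ ∑ a ∈ S, pot a := by
  refine (sum_image_le_sum pot S φ).trans (Finset.sum_le_sum fun a ha => ?_)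
  rcases hw a (φ a) (fun h => hφ (Finset.prod_eq_zero ha h)) with h | h
  · rw [h]
  · exact h.le

omit [Fintype ι] in
/-- … and **lowers it strictly unless it is the identity on `S`**. -/
theorem pot_image_eq (w : ι → ι → ℂ) (pot : ι → ℕ) (hw : ∀ a q, w a q ≠ 0 → q = a ∨ pot q < pot a)
    (S : Finset ι) (φ : ι → ι) (hφ : ∏ a ∈ S, w a (φ a) ≠ 0)
    (heq : ∑ q ∈ S.image φ, pot q = ∑ a ∈ S, pot a) : ∀ a ∈ S, φ a = a := by
  by_contra hne
  push Not at hne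
  obtain ⟨a₀, ha₀, hφa₀⟩ := hne
  have hlt : ∑ a ∈ S, pot (φ a) < ∑ a ∈ S, pot a := by
    refine Finset.sum_lt_sum (fun a ha => ?_) ⟨a₀, ha₀, ?_⟩
    · rcases hw a (φ a) (fun h => hφ (Finset.prod_eq_zero ha h)) with h | h
      · rw [h]
      · exact h.le
    · rcases hw a₀ (φ a₀) (fun h => hφ (Finset.prod_eq_zero ha₀ h)) with h | h
      · exact (hφa₀ h).elim
      · exact h
  have := sum_image_le_sum pot S φ
  omega

/-! ## The dual-vector criterion -/

/-- the transfer coefficient of the identity: `C(S, S) = 1` for a unipotent table. -/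
theorem transfer_diag (w : ι → ι → ℂ) (pot : ι → ℕ) (hw : ∀ a q, w a q ≠ 0 → q = a ∨ pot q < pot a)
    (hdiag : ∀ a, w a a = 1) (S : Finset ι) :
    ∑ φ ∈ Fintype.piFinset (fun a => if a ∈ S then (Finset.univ : Finset ι) else {a}),
      (if S.image φ = S then ∏ a ∈ S, w a (φ a) else 0) = 1 := by
  classical
  rw [Finset.sum_eq_single (fun a => a)]
  · rw [if_pos (by simp), Finset.prod_congr rfl fun a _ => hdiag a, Finset.prod_const_one]
  · intro φ hφ hne
    by_cases himg : S.image φ = S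
    · rw [if_pos himg]
      by_contra hprod
      apply hne
      have hid := pot_image_eq w pot hw S φ hprod (by rw [himg])
      funext a
      by_cases ha : a ∈ S
      · exact hid a ha
      · have := Fintype.mem_piFinset.1 hφ a
        rw [if_neg ha, Finset.mem_singleton] at this
        exact this
    · rw [if_neg himg]
  · intro h
    exact (h (Fintype.mem_piFinset.2 fun a => by split_ifs <;> simp)).elim

/-- the transfer coefficient `C(S*, S)` vanishes when `S ≠ S*` does not exceed `S*` in potential. -/
theorem transfer_offdiag (w : ι → ι → ℂ) (pot : ι → ℕ) (hw : ∀ a q, w a q ≠ 0 → q = a ∨ pot q < pot a)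
    {S T : Finset ι} (hne : S ≠ T) (hle : ∑ a ∈ S, pot a ≤ ∑ a ∈ T, pot a) :
    ∑ φ ∈ Fintype.piFinset (fun a => if a ∈ S then (Finset.univ : Finset ι) else {a}),
      (if S.image φ = T then ∏ a ∈ S, w a (φ a) else 0) = 0 := by
  refine Finset.sum_eq_zero fun φ _ => ?_
  by_cases himg : S.image φ = T
  · rw [if_pos himg]
    by_contra hprod
    have h1 := pot_image_le w pot hw S φ hprod
    rw [himg] at h1
    have hid := pot_image_eq w pot hw S φ hprod (by rw [himg]; omega)
    apply hne
    rw [← himg]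
    ext q
    simp only [Finset.mem_image]
    constructor
    · intro hq; exact ⟨q, hq, hid q hq⟩
    · rintro ⟨a, ha, rfl⟩; rw [hid a ha]; exact ha
  · rw [if_neg himg]

/-- ★ **THE DUAL-VECTOR CRITERION.**  Unipotent table `w`; a function `ζ` on sets, supported on `|R| ≤ k`, that annihilates
every row `S ≠ X₀` with `|S| ≤ k` (`Σ_φ wt(φ) ζ(S.image φ) = 0`) and does not annihilate the row `Y₀`.  Then any linear
relation `Σ_S v S · (∏_{a∈S} Σ_{q∈J} w a q) = 0` holding at every point `J` with `|J| ≤ k`, with `v` supported on the rows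
`{|S| ≤ k, S ≠ X₀} ∪ {Y₀}`, is trivial. -/
theorem coeffs_eq_zero_of_dual (w : ι → ι → ℂ) (pot : ι → ℕ)
    (hw : ∀ a q, w a q ≠ 0 → q = a ∨ pot q < pot a) (hdiag : ∀ a, w a a = 1)
    (k : ℕ) (X₀ Y₀ : Finset ι) (ζ : Finset ι → ℂ) (hζ : ∀ R, k < R.card → ζ R = 0)
    (hA : ∀ S, S.card ≤ k → S ≠ X₀ →
      ∑ φ ∈ Fintype.piFinset (fun a => if a ∈ S then (Finset.univ : Finset ι) else {a}),
        (∏ a ∈ S, w a (φ a)) * ζ (S.image φ) = 0)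
    (hB : ∑ φ ∈ Fintype.piFinset (fun a => if a ∈ Y₀ then (Finset.univ : Finset ι) else {a}),
        (∏ a ∈ Y₀, w a (φ a)) * ζ (Y₀.image φ) ≠ 0)
    (v : Finset ι → ℂ) (hv : ∀ S, v S ≠ 0 → (S.card ≤ k ∧ S ≠ X₀) ∨ S = Y₀)
    (h0 : ∀ J : Finset ι, J.card ≤ k → ∑ S, v S * ∏ a ∈ S, ∑ q ∈ J, w a q = 0) :
    ∀ S, v S = 0 := by
  classical
  -- the transfer coefficients and their `v`-combination
  set C : Finset ι → Finset ι → ℂ := fun R S =>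
    ∑ φ ∈ Fintype.piFinset (fun a => if a ∈ S then (Finset.univ : Finset ι) else {a}),
      (if S.image φ = R then ∏ a ∈ S, w a (φ a) else 0) with hC
  set g : Finset ι → ℂ := fun R => ∑ S, v S * C R S with hg
  -- Step 1–2: Möbius inversion gives `g R = 0` for `|R| ≤ k`
  have hg0 : ∀ R : Finset ι, R.card ≤ k → g R = 0 := by
    apply moebius_zero
    intro J hJ
    calc ∑ R ∈ J.powerset, g R = ∑ S, v S * ∑ R ∈ J.powerset, C R S := by
          rw [Finset.sum_comm]
          exact Finset.sum_congr rfl fun S _ => by rw [Finset.mul_sum]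
      _ = ∑ S, v S * ∏ a ∈ S, ∑ q ∈ J, w a q :=
          Finset.sum_congr rfl fun S _ => by rw [mono_eq_sum_powerset]
      _ = 0 := h0 J hJ
  -- Step 3: pair with `ζ`
  have hΛ : ∀ S, ∑ R, ζ R * C R S =
      ∑ φ ∈ Fintype.piFinset (fun a => if a ∈ S then (Finset.univ : Finset ι) else {a}),
        (∏ a ∈ S, w a (φ a)) * ζ (S.image φ) := by
    intro S
    simp only [hC, Finset.mul_sum]
    rw [Finset.sum_comm]
    refine Finset.sum_congr rfl fun φ _ => ?_
    rw [Finset.sum_eq_single (S.image φ)]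
    · rw [if_pos rfl, mul_comm]
    · intro R _ hR; rw [if_neg (Ne.symm hR), mul_zero]
    · intro h; exact (h (Finset.mem_univ _)).elim
  have hY : v Y₀ = 0 := by
    have h1 : ∑ R, ζ R * g R = 0 := by
      refine Finset.sum_eq_zero fun R _ => ?_
      by_cases hR : R.card ≤ k
      · rw [hg0 R hR, mul_zero]
      · rw [hζ R (by omega), zero_mul]
    have h2 : ∑ R, ζ R * g R = ∑ S, v S * ∑ R, ζ R * C R S := by
      simp only [hg, Finset.mul_sum]
      rw [Finset.sum_comm]
      exact Finset.sum_congr rfl fun S _ => Finset.sum_congr rfl fun R _ => by ring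
    rw [h2, Finset.sum_eq_single Y₀] at h1
    · rw [hΛ] at h1
      exact (mul_eq_zero.1 h1).resolve_right hB
    · intro S _ hS
      by_cases hvS : v S = 0
      · rw [hvS, zero_mul]
      · rcases hv S hvS with ⟨hcard, hX⟩ | h
        · rw [hΛ, hA S hcard hX, mul_zero]
        · exact (hS h).elim
    · intro h; exact (h (Finset.mem_univ _)).elim
  -- Step 4: unipotence
  by_contra hne
  push Not at hne
  have hT : (Finset.univ.filter fun S : Finset ι => v S ≠ 0).Nonempty := by
    obtain ⟨S, hS⟩ := hne
    exact ⟨S, Finset.mem_filter.2 ⟨Finset.mem_univ _, hS⟩⟩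
  obtain ⟨T, hT1, hTmax⟩ :=
    Finset.exists_max_image (Finset.univ.filter fun S : Finset ι => v S ≠ 0) (fun S => ∑ a ∈ S, pot a) hT
  have hvT : v T ≠ 0 := (Finset.mem_filter.1 hT1).2
  have hTk : T.card ≤ k := by
    rcases hv T hvT with ⟨h, -⟩ | h
    · exact h
    · exact absurd (h ▸ hY) hvT
  have hgT := hg0 T hTk
  simp only [hg] at hgT
  rw [Finset.sum_eq_single T] at hgT
  · have hCT : C T T = 1 := transfer_diag w pot hw hdiag T
    rw [hCT, mul_one] at hgT
    exact hvT hgT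
  · intro S _ hS
    by_cases hvS : v S = 0
    · rw [hvS, zero_mul]
    · have hle := hTmax S (Finset.mem_filter.2 ⟨Finset.mem_univ _, hvS⟩)
      show v S * C T S = 0
      rw [show C T S = 0 from transfer_offdiag w pot hw hS hle, mul_zero]
  · intro h; exact (h (Finset.mem_univ _)).elim

/-- ★ **DETERMINANT FORM.**  Under the hypotheses of `coeffs_eq_zero_of_dual`, every square matrix whose rows are an injective
enumeration of rows from `{|S| ≤ k, S ≠ X₀} ∪ {Y₀}` and whose columns enumerate ALL points `|J| ≤ k` (possibly with repetitions) —
entry `∏_{a ∈ S_i} Σ_{q ∈ J_kk} w a q` — has nonzero determinant. -/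
theorem det_ne_zero_of_dual (w : ι → ι → ℂ) (pot : ι → ℕ)
    (hw : ∀ a q, w a q ≠ 0 → q = a ∨ pot q < pot a) (hdiag : ∀ a, w a a = 1)
    (k : ℕ) (X₀ Y₀ : Finset ι) (ζ : Finset ι → ℂ) (hζ : ∀ R, k < R.card → ζ R = 0)
    (hA : ∀ S, S.card ≤ k → S ≠ X₀ →
      ∑ φ ∈ Fintype.piFinset (fun a => if a ∈ S then (Finset.univ : Finset ι) else {a}),
        (∏ a ∈ S, w a (φ a)) * ζ (S.image φ) = 0)
    (hB : ∑ φ ∈ Fintype.piFinset (fun a => if a ∈ Y₀ then (Finset.univ : Finset ι) else {a}),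
        (∏ a ∈ Y₀, w a (φ a)) * ζ (Y₀.image φ) ≠ 0)
    {r : ℕ} (rowS colJ : Fin r → Finset ι) (hinj : Function.Injective rowS)
    (hrow : ∀ i, ((rowS i).card ≤ k ∧ rowS i ≠ X₀) ∨ rowS i = Y₀)
    (hcol : ∀ J : Finset ι, J.card ≤ k → ∃ kk, colJ kk = J) :
    (Matrix.of fun i kk : Fin r => ∏ a ∈ rowS i, ∑ q ∈ colJ kk, w a q).det ≠ 0 := by
  classical
  set M : Matrix (Fin r) (Fin r) ℂ := Matrix.of fun i kk : Fin r => ∏ a ∈ rowS i, ∑ q ∈ colJ kk, w a q with hM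
  suffices h : Function.Injective M.vecMul by
    have hu : IsUnit M := Matrix.vecMul_injective_iff_isUnit.1 h
    rw [Matrix.isUnit_iff_isUnit_det, isUnit_iff_ne_zero] at hu
    exact hu
  -- trivial kernel
  refine (injective_iff_map_eq_zero (Matrix.vecMulLinear M)).2 fun c hc => ?_
  change Matrix.vecMul c M = 0 at hc
  -- the coefficient function on rows
  let v : Finset ι → ℂ := fun S => ∑ i ∈ Finset.univ.filter (fun i => rowS i = S), c i
  have hvS : ∀ i, v (rowS i) = c i := by
    intro i
    have : Finset.univ.filter (fun i' => rowS i' = rowS i) = {i} := by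
      ext i'
      simp only [Finset.mem_filter, Finset.mem_univ, true_and, Finset.mem_singleton]
      exact ⟨fun h => hinj h, fun h => by rw [h]⟩
    simp only [v, this, Finset.sum_singleton]
  have hv : ∀ S, v S ≠ 0 → (S.card ≤ k ∧ S ≠ X₀) ∨ S = Y₀ := by
    intro S hS
    obtain ⟨i, hi, -⟩ := Finset.exists_ne_zero_of_sum_ne_zero hS
    have hiS : rowS i = S := (Finset.mem_filter.1 hi).2
    rw [← hiS]
    exact hrow i
  have h0 : ∀ J : Finset ι, J.card ≤ k → ∑ S, v S * ∏ a ∈ S, ∑ q ∈ J, w a q = 0 := by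
    intro J hJ
    obtain ⟨kk, hkk⟩ := hcol J hJ
    have hck : (Matrix.vecMul c M) kk = 0 := by rw [hc]; rfl
    rw [Matrix.vecMul, dotProduct] at hck
    calc ∑ S, v S * ∏ a ∈ S, ∑ q ∈ J, w a q
        = ∑ S, ∑ i ∈ Finset.univ.filter (fun i => rowS i = S), c i * ∏ a ∈ S, ∑ q ∈ J, w a q :=
          Finset.sum_congr rfl fun S _ => by simp only [v, Finset.sum_mul]
      _ = ∑ i, c i * ∏ a ∈ rowS i, ∑ q ∈ J, w a q := by
          rw [← Finset.sum_fiberwise_of_maps_to (s := (Finset.univ : Finset (Fin r))) (t := (Finset.univ : Finset (Finset ι)))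
            (g := rowS) (fun _ _ => Finset.mem_univ _)]
          refine Finset.sum_congr rfl fun S _ => Finset.sum_congr rfl fun i hi => ?_
          rw [(Finset.mem_filter.1 hi).2]
      _ = ∑ i, c i * M i kk := Finset.sum_congr rfl fun i _ => by rw [hM, Matrix.of_apply, hkk]
      _ = 0 := hck
  have hzero := coeffs_eq_zero_of_dual w pot hw hdiag k X₀ Y₀ ζ hζ hA hB v hv h0
  funext i
  rw [← hvS i, hzero]
  rfl

end PathTable

end

end Summit.ValiantsHypothesis.ValiantsHypothesis.Theorems.BarrierLever.HiddenStates
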